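import Literature.AlgebraicGeometry.Motives.MumfordTateGroupDirectSum
import Literature.AlgebraicGeometry.Motives.HodgeStructureInternalHomRigidity
import Mathlib.LinearAlgebra.Dual.BaseChange
import HarnessLib

/-!
# `MT(V^∗) ≅ MT(V)` under `g ↦ (g^∗)⁻¹` (Moonen 1999, (1.8)), on `K`-points and on `ℚ`-points

Layer `Literature/AlgebraicGeometry/Motives` (lane `lit-hodgefound`, Track 2 foundations library; seat
`lit-hodgefound-p34`, row g10-#2). THEOREMS plus plumbing definitions with bodies (the contragredient
homomorphism, the comparison isomorphism of tensor spaces of the dual, its Hodge-structure form); no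
named fact is introduced (net debt 0).

For a pure `ℚ`-Hodge structure `H : HodgeStructure V n` on a finite-dimensional `V`, the tree's dual
`H.dual : HodgeStructure (V^∨) (-n)` (`Motives/HodgeTensor`), and the tensor-stabiliser groups
`MT(H)(K) = H.mumfordTateGroupBaseChange K ≤ GL(K ⊗ V)`, `Hg(H)(K) = H.hodgeGroupBaseChange K`
(`Motives/EtaleTate`, `Motives/HodgeStructureDeligneTorusMumfordTate`), `H.mumfordTateGroup`,
`H.hodgeGroup` (`ℚ`-points, `Motives/HodgeTensor`).

## Source, verbatim

* B. Moonen, *Notes on Mumford–Tate groups* (Centre Émile Borel, 1999) [Moonen1999MTNotes]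
  (materialised text `paper:url-c4d52097ebb3`, p. 4 L20–L28), **(1.8) Remark.** "Let `T` be a tensor
  construction as in (1.5). Write `r : GL(V) → GL(T)` for the canonical homomorphism. Then `MT(T)`
  equals the image of `MT(V)` under `r`. […] As examples of this principle, we find that `MT(V^∗)` is
  isomorphic to `MT(V)` (under the natural isomorphism `g ↦ (g^∗)⁻¹`). Also, `MT(V^{⊕n})` (`n ≥ 1`)
  is isomorphic to `MT(V)` acting diagonally on `V^{⊕n}`."
* P. Deligne, *Hodge cycles on abelian varieties* (LNM 900, art. I) [Deligne1982HodgeCycles], §3.1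
  (the tensor spaces `T^{a,b} = V^{⊗a} ⊗ (V^∨)^{⊗b}` with the induced action of `GL(V)`), Prop. 3.4.
* P. Deligne, J. S. Milne, *Tannakian categories* (LNM 900, art. II) [DeligneMilne1982Tannakian], §1
  (1.6.6) (the transpose `ᵗf`), (1.6.7)–Def. 1.7 (`i_X : X → X^∨∨`, reflexivity), Def. 1.1 (the
  commutativity constraint `ψ`) — the tree's `Hom.dualMap`, `Hom.bidual` / `Hom.bidualInv`,
  `Hom.tensorComm` / `Hom.tensorCommSymm`.

## Mechanism

The comparison `Θ : T^{a,b}(H^∨) = (H^∨)^{⊗a} ⊗ (H^∨∨)^{⊗b} → T^{b,a}(H)`, `Θ = ψ ∘ (id^{⊗a} ⊗ (i_X⁻¹)^{⊗b})`,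
is a morphism of Hodge structures onto a weight-cast of `T^{b,a}(H)` (`Hom.dualTensorSpace`), with a
morphism inverse (`Hom.dualTensorSpaceInv`); so it carries the Hodge tensors of `H^∨` of type `(p,p)`
onto those of `H` (`dualTensorSpaceEquiv_mem_hodgeClasses`, `…_symm_mem_hodgeClasses`). Over a field
`K ⊇ ℚ` the `K`-form `Θ_K : T^{a,b}_K(K ⊗ V^∨) ≃ T^{b,a}_K(K ⊗ V)` (`dualTensorSpaceEquiv δ_K`, through
Mathlib's `δ_K = IsBaseChange.toDualBaseChange : K ⊗ V^∨ ≃ (K ⊗ V)^∨` and `δ_K⁻ᵀ` followed by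
`Module.evalEquiv⁻¹`) satisfies `Θ_K ∘ ι_K = ι_K ∘ Θ` (`dualTensorSpaceEquiv_tensorSpaceToBaseChange`) and
`Θ_K ∘ ρ(γᶜ) = ρ(γ) ∘ Θ_K` for the contragredient `γᶜ = δ_K⁻¹ (γ⁻¹)ᵀ δ_K`
(`dualTensorSpaceEquiv_tensorSpaceActOver`); injectivity of `Θ_K` transfers invariance in both
directions, and `γ ↦ γᶜ` is surjective (`contragredientOver_rightInverse`), whence the equality of
subgroups.

## What is proved

* §1 (linear algebra over a field `K`; `δ : W' ≃ W^∨`, `W` reflexive): `contragredientOver δ :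
  GL(W) →* GL(W')`, `γ ↦ δ⁻¹ (γ⁻¹)ᵀ δ` (+ `_apply`, `apply_contragredientOver_apply`,
  `contragredientOver_symm_apply`, `contragredientOver_rightInverse`, `_surjective`); `codualEquiv δ :
  (W')^∨ ≃ W`; `dualTensorSpaceEquiv δ a b : T^{a,b}_K W' ≃ T^{b,a}_K W` and its **equivariance**
  `dualTensorSpaceEquiv_tensorSpaceActOver`.
* §1b (`K ⊇ ℚ`, `V` finite-dimensional): `dualBaseChangeEquivOver K V = δ_K` (+ `_one_tmul`,
  `codualEquiv_dualBaseChange`), **`dualTensorSpaceEquiv_tensorSpaceToBaseChange`** (`Θ_K ι_K = ι_K Θ`),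
  `contragredient K V : GL(K ⊗ V) →* GL(K ⊗ V^∨)`.
* §2 (Hodge structures): `Hom.dualTensorSpace`, `Hom.dualTensorSpaceInv`,
  `dualTensorSpaceEquiv_mem_hodgeClasses`, `dualTensorSpaceEquiv_symm_mem_hodgeClasses`.
* §3 **Moonen (1.8), first example, on `K`-points, every field `K ⊇ ℚ`**:
  `contragredient_mem_mumfordTateGroupBaseChange_dual` (`γ ∈ MT(H)(K) ⟹ γᶜ ∈ MT(H^∨)(K)`),
  `mem_mumfordTateGroupBaseChange_of_contragredient_mem` (converse), `…_iff`,
  **`mumfordTateGroupBaseChange_dual_eq : MT(H^∨)(K) = (MT(H)(K)).map (contragredient K V)`**, and the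
  Hodge-group twins (**`hodgeGroupBaseChange_dual_eq`**).
* §4 **`ℚ`-points**: `symm_dualMap_mem_mumfordTateGroup_dual_iff : g⁻ᵀ ∈ MT(H^∨) ↔ g ∈ MT(H)`,
  `symm_dualMap_mem_hodgeGroup_dual_iff`, `mumfordTateGroup_dual_eq`, `hodgeGroup_dual_eq`.
-/

noncomputable section

open scoped TensorProduct PiTensorProduct

namespace Literature.AlgebraicGeometry.Motives

/-! ### §1 The contragredient and the comparison `T^{a,b}_K W' ≃ T^{b,a}_K W` along `δ : W' ≃ W^∨` -/

section LinearAlgebra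

universe uK u₁ u₂

variable {K : Type uK} [Field K] {W : Type u₁} [AddCommGroup W] [Module K W]
  {W' : Type u₂} [AddCommGroup W'] [Module K W'] (δ : W' ≃ₗ[K] Module.Dual K W)

/-- **The contragredient homomorphism `GL(W) →* GL(W')`, `γ ↦ δ⁻¹ ∘ (γ⁻¹)ᵀ ∘ δ`**, along an
identification `δ : W' ≃ W^∨` — Moonen's "natural isomorphism `g ↦ (g^∗)⁻¹`" from `GL(V)` to `GL(V^∗)`,
written for a model `W'` of the dual. [cite: Moonen1999MTNotes, (1.8)] [cite: DeligneMilne1982Tannakian, §1 (1.6.6) (LNM 900 p0085)] -/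
def contragredientOver : (W ≃ₗ[K] W) →* (W' ≃ₗ[K] W') where
  toFun γ := δ.trans (γ.symm.dualMap.trans δ.symm)
  map_one' := by
    refine LinearEquiv.ext fun x => ?_
    change δ.symm ((1 : W ≃ₗ[K] W).symm.dualMap (δ x)) = x
    have h : (1 : W ≃ₗ[K] W).symm.dualMap (δ x) = δ x := LinearMap.ext fun _ => rfl
    rw [h, LinearEquiv.symm_apply_apply]
  map_mul' γ γ' := by
    refine LinearEquiv.ext fun x => ?_
    change δ.symm ((γ * γ').symm.dualMap (δ x)) =
      δ.symm (γ.symm.dualMap (δ (δ.symm (γ'.symm.dualMap (δ x)))))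
    rw [LinearEquiv.apply_symm_apply]
    exact congrArg δ.symm (LinearMap.ext fun _ => rfl)

/-- `γᶜ x = δ⁻¹ ((δ x) ∘ γ⁻¹)`. [cite: Moonen1999MTNotes, (1.8)] -/
theorem contragredientOver_apply (γ : W ≃ₗ[K] W) (x : W') :
    contragredientOver δ γ x = δ.symm (γ.symm.dualMap (δ x)) :=
  rfl

/-- `δ (γᶜ x) = (δ x) ∘ γ⁻¹`. [cite: Moonen1999MTNotes, (1.8)] -/
@[simp]
theorem apply_contragredientOver_apply (γ : W ≃ₗ[K] W) (x : W') :
    δ (contragredientOver δ γ x) = (δ x).comp (γ.symm : W →ₗ[K] W) := by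
  rw [contragredientOver_apply, LinearEquiv.apply_symm_apply]
  rfl

/-- `(γᶜ)⁻¹ = (γ⁻¹)ᶜ`, i.e. `(γᶜ)⁻¹ x = δ⁻¹ ((δ x) ∘ γ)`. [cite: Moonen1999MTNotes, (1.8)] -/
theorem contragredientOver_symm_apply (γ : W ≃ₗ[K] W) (x : W') :
    (contragredientOver δ γ).symm x = δ.symm ((δ x).comp (γ : W →ₗ[K] W)) := by
  have h : (contragredientOver δ γ).symm = contragredientOver δ γ⁻¹ := (map_inv (contragredientOver δ) γ).symm
  rw [h]
  rfl

/-- `δ ((γᶜ)⁻¹ x) = (δ x) ∘ γ`. [cite: Moonen1999MTNotes, (1.8)] -/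
@[simp]
theorem apply_contragredientOver_symm_apply (γ : W ≃ₗ[K] W) (x : W') :
    δ ((contragredientOver δ γ).symm x) = (δ x).comp (γ : W →ₗ[K] W) := by
  rw [contragredientOver_symm_apply, LinearEquiv.apply_symm_apply]

variable [Module.IsReflexive K W]

/-- **The identification `(W')^∨ ≃ W`** induced by `δ : W' ≃ W^∨`: `δ⁻ᵀ : (W')^∨ ≃ W^∨∨` followed by the
inverse of `i_W : W ≃ W^∨∨` (`Module.evalEquiv`; `W` reflexive). [cite: DeligneMilne1982Tannakian, §1 (1.6.7)–Def. 1.7 (LNM 900 p0087)] -/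
def codualEquiv : Module.Dual K W' ≃ₗ[K] W :=
  δ.symm.dualMap.trans (Module.evalEquiv K W).symm

/-- `codualEquiv δ ψ = i_W⁻¹ (ψ ∘ δ⁻¹)`. [cite: DeligneMilne1982Tannakian, §1 Def. 1.7 (LNM 900 p0087)] -/
theorem codualEquiv_apply (ψ : Module.Dual K W') :
    codualEquiv δ ψ = (Module.evalEquiv K W).symm (δ.symm.dualMap ψ) :=
  rfl

omit [AddCommGroup W'] [Module K W'] in
/-- Along `δ = id_{W^∨}`, `codualEquiv` is `i_W⁻¹ : W^∨∨ ≃ W`. [cite: DeligneMilne1982Tannakian, §1 Def. 1.7 (LNM 900 p0087)] -/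
@[simp]
theorem codualEquiv_refl_apply (Ψ : Module.Dual K (Module.Dual K W)) :
    codualEquiv (LinearEquiv.refl K (Module.Dual K W)) Ψ = (Module.evalEquiv K W).symm Ψ := by
  rw [codualEquiv_apply, LinearEquiv.refl_symm, LinearEquiv.dualMap_refl, LinearEquiv.refl_apply]

/-- The defining property of `codualEquiv`: `φ (codualEquiv δ ψ) = ψ (δ⁻¹ φ)` for `φ ∈ W^∨`.
[cite: DeligneMilne1982Tannakian, §1 Def. 1.7 (LNM 900 p0087)] -/
@[simp]
theorem apply_codualEquiv (ψ : Module.Dual K W') (φ : Module.Dual K W) :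
    φ (codualEquiv δ ψ) = ψ (δ.symm φ) := by
  rw [codualEquiv_apply, Module.apply_evalEquiv_symm_apply, LinearEquiv.dualMap_apply]

/-- **`codualEquiv` intertwines `(γᶜ)⁻ᵀ` with `γ`**: `codualEquiv δ (ψ ∘ (γᶜ)⁻¹) = γ (codualEquiv δ ψ)` (the
transpose of the transpose is `γ` on the reflexive `W`). [cite: Moonen1999MTNotes, (1.8)]
[cite: DeligneMilne1982Tannakian, §1 (1.6.6)–Def. 1.7 (LNM 900 p0085–p0087)] -/
theorem codualEquiv_comp_contragredientOver_symm (γ : W ≃ₗ[K] W) (ψ : Module.Dual K W') :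
    codualEquiv δ (ψ.comp ((contragredientOver δ γ).symm : W' →ₗ[K] W')) = γ (codualEquiv δ ψ) := by
  -- test against every functional `φ ∈ W^∨` (`W` is reflexive, so `i_W` is injective)
  apply (Module.evalEquiv K W).injective
  refine LinearMap.ext fun φ => ?_
  rw [Module.evalEquiv_apply, Module.evalEquiv_apply, Module.Dual.eval_apply, Module.Dual.eval_apply,
    apply_codualEquiv, LinearMap.comp_apply, LinearEquiv.coe_coe, contragredientOver_symm_apply,
    LinearEquiv.apply_symm_apply]
  -- `ψ (δ⁻¹ (φ ∘ γ)) = φ (γ (codualEquiv δ ψ))`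
  have h : φ (γ (codualEquiv δ ψ)) = (φ.comp (γ : W →ₗ[K] W)) (codualEquiv δ ψ) := rfl
  rw [h, apply_codualEquiv]

/-- **The comparison isomorphism `Θ : T^{a,b}_K W' ≃ T^{b,a}_K W`** along `δ : W' ≃ W^∨`:
`(⊗ w'_i) ⊗ (⊗ ψ_j) ↦ (⊗ codualEquiv ψ_j) ⊗ (⊗ δ w'_i)` — the identification
`T^{a,b}(V^∨) = (V^∨)^{⊗a} ⊗ (V^∨∨)^{⊗b} ≅ V^{⊗b} ⊗ (V^∨)^{⊗a} = T^{b,a}(V)` behind "`MT(V^∗)` is isomorphic to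
`MT(V)`". [cite: Moonen1999MTNotes, (1.8)] [cite: Deligne1982HodgeCycles, I §3.1] -/
def dualTensorSpaceEquiv (a b : ℕ) : hodgeTensorSpaceOver K W' a b ≃ₗ[K] hodgeTensorSpaceOver K W b a :=
  (TensorProduct.congr (PiTensorProduct.congr fun _ : Fin a => δ)
    (PiTensorProduct.congr fun _ : Fin b => codualEquiv δ)).trans (TensorProduct.comm K _ _)

/-- `Θ` on pure tensors. [cite: Moonen1999MTNotes, (1.8)] -/
@[simp]
theorem dualTensorSpaceEquiv_tprod_tmul_tprod {a b : ℕ} (w : Fin a → W') (ψ : Fin b → Module.Dual K W') :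
    dualTensorSpaceEquiv δ a b (PiTensorProduct.tprod K w ⊗ₜ[K] PiTensorProduct.tprod K ψ) =
      (PiTensorProduct.tprod K fun j => codualEquiv δ (ψ j)) ⊗ₜ[K] PiTensorProduct.tprod K fun i => δ (w i) := by
  simp [dualTensorSpaceEquiv]

/-- `Θ⁻¹` on pure tensors. [cite: Moonen1999MTNotes, (1.8)] -/
@[simp]
theorem dualTensorSpaceEquiv_symm_tprod_tmul_tprod {a b : ℕ} (w : Fin b → W) (φ : Fin a → Module.Dual K W) :
    (dualTensorSpaceEquiv δ a b).symm (PiTensorProduct.tprod K w ⊗ₜ[K] PiTensorProduct.tprod K φ) =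
      (PiTensorProduct.tprod K fun i => δ.symm (φ i)) ⊗ₜ[K]
        PiTensorProduct.tprod K fun j => (codualEquiv δ).symm (w j) := by
  simp [dualTensorSpaceEquiv]

/-- **Equivariance of `Θ`**: `Θ (ρ(γᶜ) t) = ρ(γ) (Θ t)`, where `ρ(γ) = γ^{⊗b} ⊗ (γ⁻ᵀ)^{⊗a}` on `T^{b,a}_K W`
and `ρ(γᶜ) = (γᶜ)^{⊗a} ⊗ ((γᶜ)⁻ᵀ)^{⊗b}` on `T^{a,b}_K W'` (`δ γᶜ = (·∘γ⁻¹) δ` and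
`codualEquiv ((γᶜ)⁻ᵀ ψ) = γ (codualEquiv ψ)`). [cite: Moonen1999MTNotes, (1.8)] [cite: Deligne1982HodgeCycles, I §3.1] -/
theorem dualTensorSpaceEquiv_tensorSpaceActOver {a b : ℕ} (γ : W ≃ₗ[K] W) (t : hodgeTensorSpaceOver K W' a b) :
    dualTensorSpaceEquiv δ a b (tensorSpaceActOver (contragredientOver δ γ) t) =
      tensorSpaceActOver γ (dualTensorSpaceEquiv δ a b t) := by
  suffices h : (dualTensorSpaceEquiv δ a b).toLinearMap ∘ₗ
        (tensorSpaceActOver (a := a) (b := b) (contragredientOver δ γ)).toLinearMap =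
      (tensorSpaceActOver (a := b) (b := a) γ).toLinearMap ∘ₗ (dualTensorSpaceEquiv δ a b).toLinearMap from
    LinearMap.congr_fun h t
  ext w ψ
  simp [codualEquiv_comp_contragredientOver_symm]

/-! #### A right inverse of the contragredient: `γ ↦ γᶜ` is surjective -/

/-- The identification `δ' : W ≃ (W')^∨` transposed from `δ`: `i_W` followed by `δᵀ`. [cite: DeligneMilne1982Tannakian, §1 (1.6.6)–Def. 1.7 (LNM 900 p0085–p0087)] -/
def transposeIdent : W ≃ₗ[K] Module.Dual K W' :=
  (Module.evalEquiv K W).trans δ.dualMap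

/-- `δ' w = (δ ·) w`, i.e. `(transposeIdent δ w) x = δ x w`. [cite: DeligneMilne1982Tannakian, §1 (1.6.6) (LNM 900 p0085)] -/
@[simp]
theorem transposeIdent_apply_apply (w : W) (x : W') : transposeIdent δ w x = δ x w := rfl

/-- `(δ y) (δ'⁻¹ χ) = χ y`. [cite: DeligneMilne1982Tannakian, §1 Def. 1.7 (LNM 900 p0087)] -/
theorem apply_transposeIdent_symm (y : W') (χ : Module.Dual K W') :
    δ y ((transposeIdent δ).symm χ) = χ y := by
  have h : (transposeIdent δ).symm χ = (Module.evalEquiv K W).symm (δ.symm.dualMap χ) := rfl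
  rw [h, Module.apply_evalEquiv_symm_apply, LinearEquiv.dualMap_apply, LinearEquiv.symm_apply_apply]

/-- **`γ' ↦ (γ')ᶜ'` along `δ'` is a right inverse of `γ ↦ γᶜ` along `δ`**: every automorphism of `W'`
is a contragredient. [cite: Moonen1999MTNotes, (1.8)] -/
theorem contragredientOver_rightInverse (γ' : W' ≃ₗ[K] W') :
    contragredientOver δ (contragredientOver (transposeIdent δ) γ') = γ' := by
  refine LinearEquiv.ext fun y => ?_
  rw [contragredientOver_apply, LinearEquiv.symm_apply_eq]
  refine LinearMap.ext fun w => ?_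
  rw [LinearEquiv.dualMap_apply, contragredientOver_symm_apply, apply_transposeIdent_symm,
    LinearMap.comp_apply, LinearEquiv.coe_coe, transposeIdent_apply_apply]

/-- `γ ↦ γᶜ` is surjective. [cite: Moonen1999MTNotes, (1.8)] -/
theorem contragredientOver_surjective : Function.Surjective (contragredientOver δ) :=
  fun γ' => ⟨_, contragredientOver_rightInverse δ γ'⟩

end LinearAlgebra

/-! ### §1b The case `W = K ⊗ V`, `W' = K ⊗ V^∨`, `δ_K : K ⊗ V^∨ ≃ (K ⊗ V)^∨` -/

section BaseChange

universe uK u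

variable (K : Type uK) [Field K] [Algebra ℚ K] (V : Type u) [AddCommGroup V] [Module ℚ V]
  [Module.Finite ℚ V]

/-- **`δ_K : K ⊗ V^∨ ≃ (K ⊗ V)^∨`**, the base change of the dual (Mathlib's
`IsBaseChange.toDualBaseChange` for the base change `v ↦ 1 ⊗ v`; `V` finite-dimensional).
[cite: Deligne1982HodgeCycles, I §3.1] -/
def dualBaseChangeEquivOver : K ⊗[ℚ] Module.Dual ℚ V ≃ₗ[K] Module.Dual K (K ⊗[ℚ] V) :=
  (TensorProduct.isBaseChange ℚ V K).toDualBaseChange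

variable {K V}

/-- `δ_K (c ⊗ φ) (1 ⊗ v) = c · φ(v)`. [cite: Deligne1982HodgeCycles, I §3.1] -/
theorem dualBaseChangeEquivOver_tmul_apply_one_tmul (c : K) (φ : Module.Dual ℚ V) (v : V) :
    dualBaseChangeEquivOver K V (c ⊗ₜ[ℚ] φ) ((1 : K) ⊗ₜ[ℚ] v) = c * algebraMap ℚ K (φ v) :=
  IsBaseChange.toDualBaseChange_tmul (TensorProduct.isBaseChange ℚ V K) c φ v

/-- `δ_K (c ⊗ φ) (d ⊗ v) = d c φ(v)`. [cite: Deligne1982HodgeCycles, I §3.1] -/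
theorem dualBaseChangeEquivOver_tmul_apply_tmul (c : K) (φ : Module.Dual ℚ V) (d : K) (v : V) :
    dualBaseChangeEquivOver K V (c ⊗ₜ[ℚ] φ) (d ⊗ₜ[ℚ] v) = d * (c * algebraMap ℚ K (φ v)) := by
  have h : (d ⊗ₜ[ℚ] v : K ⊗[ℚ] V) = d • ((1 : K) ⊗ₜ[ℚ] v) := by
    rw [TensorProduct.smul_tmul', smul_eq_mul, mul_one]
  rw [h, map_smul, dualBaseChangeEquivOver_tmul_apply_one_tmul, smul_eq_mul]

/-- **`δ_K (1 ⊗ φ) = φ_K`**: on `1 ⊗ V^∨` the identification `δ_K` is the tree's base change of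
functionals `Module.Dual.baseChange K` (both are `d ⊗ v ↦ d φ(v)`). [cite: Deligne1982HodgeCycles, I §3.1] -/
theorem dualBaseChangeEquivOver_one_tmul (φ : Module.Dual ℚ V) :
    dualBaseChangeEquivOver K V ((1 : K) ⊗ₜ[ℚ] φ) = Module.Dual.baseChange K φ := by
  refine LinearMap.ext fun x => ?_
  induction x using TensorProduct.induction_on with
  | zero => rw [map_zero, map_zero]
  | add x y hx hy => rw [map_add, map_add, hx, hy]
  | tmul d v =>
    rw [dualBaseChangeEquivOver_tmul_apply_tmul, Module.Dual.baseChange_apply_tmul, one_mul,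
      Algebra.smul_def, mul_comm]

/-- **`codualEquiv δ_K (Φ_K) = 1 ⊗ i_V⁻¹ Φ`** for `Φ ∈ V^∨∨`: under the identification `(K ⊗ V^∨)^∨ ≃ K ⊗ V`
the base change of a bidual vector is the base change of the vector. [cite: DeligneMilne1982Tannakian, §1 Def. 1.7 (LNM 900 p0087)]
[cite: Deligne1982HodgeCycles, I §3.1] -/
theorem codualEquiv_dualBaseChange (Φ : Module.Dual ℚ (Module.Dual ℚ V)) :
    codualEquiv (dualBaseChangeEquivOver K V) (Module.Dual.baseChange K Φ) =
      (1 : K) ⊗ₜ[ℚ] (Module.evalEquiv ℚ V).symm Φ := by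
  rw [codualEquiv_apply, LinearEquiv.symm_apply_eq, Module.evalEquiv_apply]
  refine LinearMap.ext fun ψ => ?_
  obtain ⟨ξ, rfl⟩ := (dualBaseChangeEquivOver K V).surjective ψ
  rw [LinearEquiv.dualMap_apply, LinearEquiv.symm_apply_apply, Module.Dual.eval_apply]
  induction ξ using TensorProduct.induction_on with
  | zero => rw [map_zero, map_zero, LinearMap.zero_apply]
  | add x y hx hy => rw [map_add, map_add, LinearMap.add_apply, hx, hy]
  | tmul c φ =>
    rw [Module.Dual.baseChange_apply_tmul, dualBaseChangeEquivOver_tmul_apply_one_tmul,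
      Module.apply_evalEquiv_symm_apply, Algebra.smul_def, mul_comm]

/-- **`Θ_K ∘ ι_K = ι_K ∘ Θ`**: the comparison isomorphism over `K` (along `δ_K`) and over `ℚ` (along
`δ = id_{V^∨}`) are compatible with the tree's comparison maps `ι_K = tensorSpaceToBaseChange K`
(checked on pure tensors with `dualBaseChangeEquivOver_one_tmul`, `codualEquiv_dualBaseChange`).
[cite: Deligne1982HodgeCycles, I §3.1] [cite: Moonen1999MTNotes, (1.8)] -/
theorem dualTensorSpaceEquiv_tensorSpaceToBaseChange {a b : ℕ} (t : hodgeTensorSpace (Module.Dual ℚ V) a b) :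
    dualTensorSpaceEquiv (dualBaseChangeEquivOver K V) a b
        (tensorSpaceToBaseChange K (Module.Dual ℚ V) a b t) =
      tensorSpaceToBaseChange K V b a
        (dualTensorSpaceEquiv (LinearEquiv.refl ℚ (Module.Dual ℚ V)) a b t) := by
  suffices h : ((dualTensorSpaceEquiv (dualBaseChangeEquivOver K V) a b).toLinearMap.restrictScalars ℚ) ∘ₗ
        tensorSpaceToBaseChange K (Module.Dual ℚ V) a b =
      tensorSpaceToBaseChange K V b a ∘ₗ
        (dualTensorSpaceEquiv (LinearEquiv.refl ℚ (Module.Dual ℚ V)) a b).toLinearMap from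
    LinearMap.congr_fun h t
  ext φ Φ
  simp [dualBaseChangeEquivOver_one_tmul, codualEquiv_dualBaseChange]

variable (K V)

/-- **The contragredient homomorphism `GL(K ⊗ V) →* GL(K ⊗ V^∨)`, `γ ↦ δ_K⁻¹ (γ⁻¹)ᵀ δ_K`** — Moonen's
`g ↦ (g^∗)⁻¹` on `K`-points. [cite: Moonen1999MTNotes, (1.8)] -/
def contragredient : ((K ⊗[ℚ] V) ≃ₗ[K] (K ⊗[ℚ] V)) →* ((K ⊗[ℚ] Module.Dual ℚ V) ≃ₗ[K] (K ⊗[ℚ] Module.Dual ℚ V)) :=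
  contragredientOver (dualBaseChangeEquivOver K V)

variable {K V}

/-- `contragredient K V = contragredientOver δ_K`. [cite: Moonen1999MTNotes, (1.8)] -/
theorem contragredient_eq : contragredient K V = contragredientOver (dualBaseChangeEquivOver K V) := rfl

/-- `contragredient K V` is surjective. [cite: Moonen1999MTNotes, (1.8)] -/
theorem contragredient_surjective : Function.Surjective (contragredient K V) :=
  contragredientOver_surjective _

end BaseChange

namespace HodgeStructure

/-! ### §2 The comparison `T^{a,b}(H^∨) → T^{b,a}(H)` as a morphism of Hodge structures -/

section Hodge

universe u

variable {V : Type u} [AddCommGroup V] [Module ℚ V] [Module.Finite ℚ V] [HodgeTensorFacts.{u, u}] {n : ℤ}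
  (H : HodgeStructure V n)

/-- `i_X⁻¹ : H^∨∨ → H`, re-typed with the double dual at its own weight `-(-n)` (the tree's `Hom.bidualInv`
lands in `H` from the cast `(H^∨∨).cast _`). [cite: DeligneMilne1982Tannakian, §1 Def. 1.7 (LNM 900 p0087)] -/
def Hom.bidualInv' : Hom H.dual.dual (H.cast (neg_neg n).symm) :=
  (Hom.bidualInv H).congrF (fun _ => rfl) (fun _ => rfl)

/-- `i_X : H → H^∨∨`, re-typed. [cite: DeligneMilne1982Tannakian, §1 (1.6.7) (LNM 900 p0087)] -/
def Hom.bidual' : Hom (H.cast (neg_neg n).symm) H.dual.dual :=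
  (Hom.bidual H).congrF (fun _ => rfl) (fun _ => rfl)

/-- The underlying map of `i_X⁻¹` is `Module.evalEquiv⁻¹` (both invert `Module.Dual.eval`).
[cite: DeligneMilne1982Tannakian, §1 Def. 1.7 (LNM 900 p0087)] -/
theorem Hom.bidualInv_toLinearMap_apply (Φ : Module.Dual ℚ (Module.Dual ℚ V)) :
    (Hom.bidualInv H).toLinearMap Φ = (Module.evalEquiv ℚ V).symm Φ := by
  apply (Hom.bidual_bijective H).1
  rw [Hom.bidualInv, Hom.apply_inverse_apply, Hom.bidual_toLinearMap, ← Module.evalEquiv_toLinearMap,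
    LinearEquiv.coe_coe, LinearEquiv.apply_symm_apply]

omit [Module.Finite ℚ V] [HodgeTensorFacts.{u, u}] in
/-- The weight bookkeeping `(b - a) n = (a - b) (-n)`. Private plumbing. [folklore] -/
private theorem weight_dual (a b : ℕ) : ((b : ℤ) - a) * n = ((a : ℤ) - b) * -n := by ring

/-- **The comparison `Θ : T^{a,b}(H^∨) → T^{b,a}(H)` is a morphism of Hodge structures** (target re-typed to
the weight `(a - b)(-n)` of the source): `Θ = ψ ∘ (id^{⊗a} ⊗ (i_X⁻¹)^{⊗b})` — tensor powers of morphisms,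
the tensor product of morphisms and the commutativity constraint are morphisms (the tree's
`Hom.tensorPowerMap`, `Hom.tensorMap`, `Hom.tensorComm`). Underlying map: `dualTensorSpaceEquiv (refl) a b`
(`Hom.dualTensorSpace_toLinearMap_apply`). [cite: Moonen1999MTNotes, (1.8)]
[cite: DeligneMilne1982Tannakian, §1 Def. 1.1 and Def. 1.7 (LNM 900 p0081, p0087)] [cite: DeligneHodgeII1971, 1.1.12] -/
def Hom.dualTensorSpace (a b : ℕ) :
    Hom (H.dual.tensorSpace a b) ((H.tensorSpace b a).cast (weight_dual (n := n) a b)) :=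
  Hom.congrF
    ((Hom.tensorComm (H.dual.tensorPower a) ((H.cast (neg_neg n).symm).tensorPower b)).comp
      (Hom.tensorMap (Hom.tensorPowerMap (Hom.id H.dual) a) (Hom.tensorPowerMap (Hom.bidualInv' H) b)))
    (fun _ => rfl) (fun _ => rfl)

/-- **The inverse comparison `Θ' : T^{b,a}(H) → T^{a,b}(H^∨)`**, `Θ' = (id^{⊗a} ⊗ i_X^{⊗b}) ∘ ψ⁻¹`, a morphism of
Hodge structures. [cite: Moonen1999MTNotes, (1.8)] [cite: DeligneMilne1982Tannakian, §1 Def. 1.1 and (1.6.7) (LNM 900 p0081, p0087)] -/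
def Hom.dualTensorSpaceInv (a b : ℕ) :
    Hom ((H.tensorSpace b a).cast (weight_dual (n := n) a b)) (H.dual.tensorSpace a b) :=
  Hom.congrF
    ((Hom.tensorMap (Hom.tensorPowerMap (Hom.id H.dual) a) (Hom.tensorPowerMap (Hom.bidual' H) b)).comp
      (Hom.tensorCommSymm (H.dual.tensorPower a) ((H.cast (neg_neg n).symm).tensorPower b)))
    (fun _ => rfl) (fun _ => rfl)

/-- The underlying map of `Θ` is the comparison isomorphism `dualTensorSpaceEquiv (refl)`.
[cite: Moonen1999MTNotes, (1.8)] -/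
theorem Hom.dualTensorSpace_toLinearMap_apply {a b : ℕ} (t : hodgeTensorSpace (Module.Dual ℚ V) a b) :
    (Hom.dualTensorSpace H a b).toLinearMap t =
      dualTensorSpaceEquiv (LinearEquiv.refl ℚ (Module.Dual ℚ V)) a b t := by
  suffices h : (Hom.dualTensorSpace H a b).toLinearMap =
      (dualTensorSpaceEquiv (LinearEquiv.refl ℚ (Module.Dual ℚ V)) a b).toLinearMap from
    LinearMap.congr_fun h t
  ext φ Φ
  simp [Hom.dualTensorSpace, Hom.comp, Hom.bidualInv', Hom.bidualInv_toLinearMap_apply, codualEquiv_apply,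
    LinearEquiv.dualMap_refl]

/-- The underlying map of `Θ'` is the inverse comparison isomorphism. [cite: Moonen1999MTNotes, (1.8)] -/
theorem Hom.dualTensorSpaceInv_toLinearMap_apply {a b : ℕ} (t : hodgeTensorSpace V b a) :
    (Hom.dualTensorSpaceInv H a b).toLinearMap t =
      (dualTensorSpaceEquiv (LinearEquiv.refl ℚ (Module.Dual ℚ V)) a b).symm t := by
  suffices h : (Hom.dualTensorSpaceInv H a b).toLinearMap =
      (dualTensorSpaceEquiv (LinearEquiv.refl ℚ (Module.Dual ℚ V)) a b).symm.toLinearMap from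
    LinearMap.congr_fun h t
  ext w φ
  simp [Hom.dualTensorSpaceInv, Hom.comp, Hom.bidual', codualEquiv, LinearEquiv.dualMap_refl]

/-- **`Θ` carries Hodge tensors of `H^∨` of type `(p,p)` to Hodge tensors of `H` of type `(p,p)`.**
[cite: Moonen1999MTNotes, (1.8)] [cite: Moonen2004MT, §4 Proposition 4.4] -/
theorem dualTensorSpaceEquiv_mem_hodgeClasses {a b : ℕ} {p : ℤ} {t : hodgeTensorSpace (Module.Dual ℚ V) a b}
    (ht : t ∈ (H.dual.tensorSpace a b).hodgeClasses p) :
    dualTensorSpaceEquiv (LinearEquiv.refl ℚ (Module.Dual ℚ V)) a b t ∈ (H.tensorSpace b a).hodgeClasses p := by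
  rw [← Hom.dualTensorSpace_toLinearMap_apply]
  exact Hom.map_hodgeClasses_le (Hom.dualTensorSpace H a b) p ⟨t, ht, rfl⟩

/-- **`Θ⁻¹` carries Hodge tensors of `H` of type `(p,p)` to Hodge tensors of `H^∨` of type `(p,p)`.**
[cite: Moonen1999MTNotes, (1.8)] [cite: Moonen2004MT, §4 Proposition 4.4] -/
theorem dualTensorSpaceEquiv_symm_mem_hodgeClasses {a b : ℕ} {p : ℤ} {t : hodgeTensorSpace V b a}
    (ht : t ∈ (H.tensorSpace b a).hodgeClasses p) :
    (dualTensorSpaceEquiv (LinearEquiv.refl ℚ (Module.Dual ℚ V)) a b).symm t ∈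
      (H.dual.tensorSpace a b).hodgeClasses p := by
  rw [← Hom.dualTensorSpaceInv_toLinearMap_apply]
  exact Hom.map_hodgeClasses_le (Hom.dualTensorSpaceInv H a b) p ⟨t, ht, rfl⟩

end Hodge

/-! ### §3 Moonen (1.8), first example, on `K`-points: `MT(H^∨)(K) = (MT(H)(K))ᶜ` -/

section KPoints

universe u v

variable {V : Type u} [AddCommGroup V] [Module ℚ V] [Module.Finite ℚ V] [HodgeTensorFacts.{u, u}] {n : ℤ}
  {H : HodgeStructure V n} (K : Type v) [Field K] [Algebra ℚ K]

omit [Module.Finite ℚ V] [HodgeTensorFacts.{u, u}] in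
/-- The weight condition of `T^{a,b}(H^∨)` is that of `T^{b,a}(H)`. Private plumbing. [folklore] -/
private theorem weight_cond_dual {a b : ℕ} {m : ℤ} (h : ((a : ℤ) - b) * -n = m) : ((b : ℤ) - a) * n = m := by
  rw [← h]; ring

/-- **`γ ∈ MT(H)(K) ⟹ γᶜ ∈ MT(H^∨)(K)`**, for every field `K ⊇ ℚ`: a weight-`0` Hodge tensor `s` of `H^∨` of
type `(0,0)` has `Θ s` a weight-`0` Hodge tensor of `H` of type `(0,0)`, fixed by `γ` after `ι_K`, and
`Θ_K (ρ(γᶜ) ι_K s) = ρ(γ) Θ_K ι_K s = ρ(γ) ι_K Θ s = ι_K Θ s = Θ_K ι_K s` with `Θ_K` injective.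
[cite: Moonen1999MTNotes, (1.8)] [cite: Deligne1982HodgeCycles, I Prop. 3.4] -/
theorem contragredient_mem_mumfordTateGroupBaseChange_dual {γ : (K ⊗[ℚ] V) ≃ₗ[K] (K ⊗[ℚ] V)}
    (hγ : γ ∈ H.mumfordTateGroupBaseChange K) :
    contragredient K V γ ∈ H.dual.mumfordTateGroupBaseChange K := by
  rw [mem_mumfordTateGroupBaseChange_iff]
  intro a b hab s hs
  apply (dualTensorSpaceEquiv (dualBaseChangeEquivOver K V) a b).injective
  rw [contragredient_eq, dualTensorSpaceEquiv_tensorSpaceActOver, dualTensorSpaceEquiv_tensorSpaceToBaseChange]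
  exact (mem_mumfordTateGroupBaseChange_iff K H γ).1 hγ b a (weight_cond_dual hab) _
    (dualTensorSpaceEquiv_mem_hodgeClasses H hs)

/-- **The Hodge-group twin: `γ ∈ Hg(H)(K) ⟹ γᶜ ∈ Hg(H^∨)(K)`** (Hodge tensors of every type `(p,p)` are
transported by `Θ`). [cite: Moonen1999MTNotes, (1.8) and (1.11)] -/
theorem contragredient_mem_hodgeGroupBaseChange_dual {γ : (K ⊗[ℚ] V) ≃ₗ[K] (K ⊗[ℚ] V)}
    (hγ : γ ∈ H.hodgeGroupBaseChange K) :
    contragredient K V γ ∈ H.dual.hodgeGroupBaseChange K := by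
  rw [mem_hodgeGroupBaseChange_iff]
  intro a b p hp s hs
  apply (dualTensorSpaceEquiv (dualBaseChangeEquivOver K V) a b).injective
  rw [contragredient_eq, dualTensorSpaceEquiv_tensorSpaceActOver, dualTensorSpaceEquiv_tensorSpaceToBaseChange]
  exact (mem_hodgeGroupBaseChange_iff K H γ).1 hγ b a p (weight_cond_dual hp) _
    (dualTensorSpaceEquiv_mem_hodgeClasses H hs)

omit [Module.Finite ℚ V] [HodgeTensorFacts.{u, u}] in
/-- The weight condition of `T^{b,a}(H)` is that of `T^{a,b}(H^∨)`. Private plumbing. [folklore] -/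
private theorem weight_cond_dual' {a b : ℕ} {m : ℤ} (h : ((b : ℤ) - a) * n = m) : ((a : ℤ) - b) * -n = m := by
  rw [← h]; ring

/-- **Converse: `γᶜ ∈ MT(H^∨)(K) ⟹ γ ∈ MT(H)(K)`** (every Hodge tensor `t` of `H` is `Θ s` for the Hodge tensor
`s = Θ⁻¹ t` of `H^∨`, and the same chain of equalities read backwards). [cite: Moonen1999MTNotes, (1.8)]
[cite: Deligne1982HodgeCycles, I Prop. 3.4] -/
theorem mem_mumfordTateGroupBaseChange_of_contragredient_mem {γ : (K ⊗[ℚ] V) ≃ₗ[K] (K ⊗[ℚ] V)}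
    (hγ : contragredient K V γ ∈ H.dual.mumfordTateGroupBaseChange K) :
    γ ∈ H.mumfordTateGroupBaseChange K := by
  rw [mem_mumfordTateGroupBaseChange_iff]
  intro b a hba t ht
  set Θ := dualTensorSpaceEquiv (LinearEquiv.refl ℚ (Module.Dual ℚ V)) a b with hΘ
  have hts : t = Θ (Θ.symm t) := (Θ.apply_symm_apply t).symm
  rw [hts, ← dualTensorSpaceEquiv_tensorSpaceToBaseChange, ← dualTensorSpaceEquiv_tensorSpaceActOver,
    ← contragredient_eq,
    (mem_mumfordTateGroupBaseChange_iff K H.dual _).1 hγ a b (weight_cond_dual' hba) _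
      (dualTensorSpaceEquiv_symm_mem_hodgeClasses H ht)]

/-- **Converse, Hodge group: `γᶜ ∈ Hg(H^∨)(K) ⟹ γ ∈ Hg(H)(K)`.** [cite: Moonen1999MTNotes, (1.8) and (1.11)] -/
theorem mem_hodgeGroupBaseChange_of_contragredient_mem {γ : (K ⊗[ℚ] V) ≃ₗ[K] (K ⊗[ℚ] V)}
    (hγ : contragredient K V γ ∈ H.dual.hodgeGroupBaseChange K) :
    γ ∈ H.hodgeGroupBaseChange K := by
  rw [mem_hodgeGroupBaseChange_iff]
  intro b a p hp t ht
  set Θ := dualTensorSpaceEquiv (LinearEquiv.refl ℚ (Module.Dual ℚ V)) a b with hΘ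
  have hts : t = Θ (Θ.symm t) := (Θ.apply_symm_apply t).symm
  rw [hts, ← dualTensorSpaceEquiv_tensorSpaceToBaseChange, ← dualTensorSpaceEquiv_tensorSpaceActOver,
    ← contragredient_eq,
    (mem_hodgeGroupBaseChange_iff K H.dual _).1 hγ a b p (weight_cond_dual' hp) _
      (dualTensorSpaceEquiv_symm_mem_hodgeClasses H ht)]

/-- **`γᶜ ∈ MT(H^∨)(K) ↔ γ ∈ MT(H)(K)`.** [cite: Moonen1999MTNotes, (1.8)] -/
theorem contragredient_mem_mumfordTateGroupBaseChange_dual_iff {γ : (K ⊗[ℚ] V) ≃ₗ[K] (K ⊗[ℚ] V)} :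
    contragredient K V γ ∈ H.dual.mumfordTateGroupBaseChange K ↔ γ ∈ H.mumfordTateGroupBaseChange K :=
  ⟨mem_mumfordTateGroupBaseChange_of_contragredient_mem K, contragredient_mem_mumfordTateGroupBaseChange_dual K⟩

/-- **`γᶜ ∈ Hg(H^∨)(K) ↔ γ ∈ Hg(H)(K)`.** [cite: Moonen1999MTNotes, (1.8) and (1.11)] -/
theorem contragredient_mem_hodgeGroupBaseChange_dual_iff {γ : (K ⊗[ℚ] V) ≃ₗ[K] (K ⊗[ℚ] V)} :
    contragredient K V γ ∈ H.dual.hodgeGroupBaseChange K ↔ γ ∈ H.hodgeGroupBaseChange K :=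
  ⟨mem_hodgeGroupBaseChange_of_contragredient_mem K, contragredient_mem_hodgeGroupBaseChange_dual K⟩

/-- **Moonen 1999 (1.8), first example, on `K`-points: `MT(H^∨)(K)` is the image of `MT(H)(K)` under the
contragredient `γ ↦ (γ^∗)⁻¹`**, `MT(H^∨)(K) = (MT(H)(K)).map (contragredient K V)`, for every field `K ⊇ ℚ`.
[cite: Moonen1999MTNotes, (1.8)] -/
theorem mumfordTateGroupBaseChange_dual_eq :
    H.dual.mumfordTateGroupBaseChange K = (H.mumfordTateGroupBaseChange K).map (contragredient K V) := by
  ext γ'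
  constructor
  · intro hγ'
    obtain ⟨γ, rfl⟩ := contragredient_surjective γ'
    exact ⟨γ, mem_mumfordTateGroupBaseChange_of_contragredient_mem K hγ', rfl⟩
  · rintro ⟨γ, hγ, rfl⟩
    exact contragredient_mem_mumfordTateGroupBaseChange_dual K hγ

/-- **The Hodge-group twin: `Hg(H^∨)(K) = (Hg(H)(K)).map (contragredient K V)`.** [cite: Moonen1999MTNotes, (1.8) and (1.11)] -/
theorem hodgeGroupBaseChange_dual_eq :
    H.dual.hodgeGroupBaseChange K = (H.hodgeGroupBaseChange K).map (contragredient K V) := by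
  ext γ'
  constructor
  · intro hγ'
    obtain ⟨γ, rfl⟩ := contragredient_surjective γ'
    exact ⟨γ, mem_hodgeGroupBaseChange_of_contragredient_mem K hγ', rfl⟩
  · rintro ⟨γ, hγ, rfl⟩
    exact contragredient_mem_hodgeGroupBaseChange_dual K hγ

/-- The contragredient restricts to a homomorphism `MT(H)(K) →* MT(H^∨)(K)`. [cite: Moonen1999MTNotes, (1.8)] -/
def mumfordTateGroupBaseChange.contragredientHom :
    H.mumfordTateGroupBaseChange K →* H.dual.mumfordTateGroupBaseChange K where
  toFun γ := ⟨contragredient K V γ.1, contragredient_mem_mumfordTateGroupBaseChange_dual K γ.2⟩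
  map_one' := Subtype.ext (map_one _)
  map_mul' _ _ := Subtype.ext (map_mul _ _ _)

/-- `MT(H)(K) →* MT(H^∨)(K)` is `γ ↦ γᶜ`. [cite: Moonen1999MTNotes, (1.8)] -/
@[simp]
theorem mumfordTateGroupBaseChange.coe_contragredientHom_apply (γ : H.mumfordTateGroupBaseChange K) :
    ((mumfordTateGroupBaseChange.contragredientHom K γ : H.dual.mumfordTateGroupBaseChange K) :
        (K ⊗[ℚ] Module.Dual ℚ V) ≃ₗ[K] (K ⊗[ℚ] Module.Dual ℚ V)) = contragredient K V γ :=
  rfl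

/-- **`MT(H)(K) →* MT(H^∨)(K)` is surjective** ("`MT(V^∗)` is isomorphic to `MT(V)`", on `K`-points: every
element of `MT(H^∨)(K)` is a contragredient of an element of `MT(H)(K)`). [cite: Moonen1999MTNotes, (1.8)] -/
theorem mumfordTateGroupBaseChange.contragredientHom_surjective :
    Function.Surjective (mumfordTateGroupBaseChange.contragredientHom (H := H) K) := by
  rintro ⟨γ', hγ'⟩
  obtain ⟨γ, rfl⟩ := contragredient_surjective γ'
  exact ⟨⟨γ, mem_mumfordTateGroupBaseChange_of_contragredient_mem K hγ'⟩, rfl⟩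

end KPoints

/-! ### §4 `ℚ`-points: `g⁻ᵀ ∈ MT(H^∨) ↔ g ∈ MT(H)` -/

section RatPoints

universe u

variable {V : Type u} [AddCommGroup V] [Module ℚ V] [Module.Finite ℚ V] [HodgeTensorFacts.{u, u}] {n : ℤ}
  {H : HodgeStructure V n}

omit [Module.Finite ℚ V] [HodgeTensorFacts.{u, u}] in
/-- Along `δ = id_{V^∨}` the contragredient is `g ↦ (g⁻¹)ᵀ = g.symm.dualMap`. [cite: Moonen1999MTNotes, (1.8)] -/
theorem contragredientOver_refl_apply (g : V ≃ₗ[ℚ] V) :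
    contragredientOver (LinearEquiv.refl ℚ (Module.Dual ℚ V)) g = g.symm.dualMap :=
  LinearEquiv.ext fun _ => rfl

omit [Module.Finite ℚ V] [HodgeTensorFacts.{u, u}] in
/-- The weight bookkeeping, `ℚ`-points. Private plumbing. [folklore] -/
private theorem weight_cond_dual_rat {a b : ℕ} {m : ℤ} (h : ((a : ℤ) - b) * -n = m) : ((b : ℤ) - a) * n = m := by
  rw [← h]; ring

omit [Module.Finite ℚ V] [HodgeTensorFacts.{u, u}] in
/-- The weight bookkeeping, `ℚ`-points, reversed. Private plumbing. [folklore] -/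
private theorem weight_cond_dual_rat' {a b : ℕ} {m : ℤ} (h : ((b : ℤ) - a) * n = m) : ((a : ℤ) - b) * -n = m := by
  rw [← h]; ring

/-- **`(g⁻¹)ᵀ ∈ MT(H^∨)` for `g ∈ MT(H)`** (`ℚ`-points). [cite: Moonen1999MTNotes, (1.8)] -/
theorem symm_dualMap_mem_mumfordTateGroup_dual {g : V ≃ₗ[ℚ] V} (hg : g ∈ H.mumfordTateGroup) :
    g.symm.dualMap ∈ H.dual.mumfordTateGroup := by
  rw [mem_mumfordTateGroup_iff]
  intro a b hab s hs
  rw [← tensorSpaceActOver_rat, ← contragredientOver_refl_apply]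
  apply (dualTensorSpaceEquiv (LinearEquiv.refl ℚ (Module.Dual ℚ V)) a b).injective
  rw [dualTensorSpaceEquiv_tensorSpaceActOver, tensorSpaceActOver_rat]
  exact (mem_mumfordTateGroup_iff H g).1 hg b a (weight_cond_dual_rat hab) _
    (dualTensorSpaceEquiv_mem_hodgeClasses H hs)

/-- **`(g⁻¹)ᵀ ∈ Hg(H^∨)` for `g ∈ Hg(H)`** (`ℚ`-points). [cite: Moonen1999MTNotes, (1.8) and (1.11)] -/
theorem symm_dualMap_mem_hodgeGroup_dual {g : V ≃ₗ[ℚ] V} (hg : g ∈ H.hodgeGroup) :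
    g.symm.dualMap ∈ H.dual.hodgeGroup := by
  rw [mem_hodgeGroup_iff]
  intro a b p hp s hs
  rw [← tensorSpaceActOver_rat, ← contragredientOver_refl_apply]
  apply (dualTensorSpaceEquiv (LinearEquiv.refl ℚ (Module.Dual ℚ V)) a b).injective
  rw [dualTensorSpaceEquiv_tensorSpaceActOver, tensorSpaceActOver_rat]
  exact (mem_hodgeGroup_iff H g).1 hg b a p (weight_cond_dual_rat hp) _
    (dualTensorSpaceEquiv_mem_hodgeClasses H hs)

/-- **Converse, `ℚ`-points: `(g⁻¹)ᵀ ∈ MT(H^∨) ⟹ g ∈ MT(H)`.** [cite: Moonen1999MTNotes, (1.8)] -/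
theorem mem_mumfordTateGroup_of_symm_dualMap_mem {g : V ≃ₗ[ℚ] V} (hg : g.symm.dualMap ∈ H.dual.mumfordTateGroup) :
    g ∈ H.mumfordTateGroup := by
  rw [mem_mumfordTateGroup_iff]
  intro b a hba t ht
  set Θ := dualTensorSpaceEquiv (LinearEquiv.refl ℚ (Module.Dual ℚ V)) a b with hΘ
  have hts : t = Θ (Θ.symm t) := (Θ.apply_symm_apply t).symm
  rw [← tensorSpaceActOver_rat, hts, ← dualTensorSpaceEquiv_tensorSpaceActOver, contragredientOver_refl_apply,
    tensorSpaceActOver_rat,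
    (mem_mumfordTateGroup_iff H.dual _).1 hg a b (weight_cond_dual_rat' hba) _
      (dualTensorSpaceEquiv_symm_mem_hodgeClasses H ht)]

/-- **Converse, `ℚ`-points, Hodge group.** [cite: Moonen1999MTNotes, (1.8) and (1.11)] -/
theorem mem_hodgeGroup_of_symm_dualMap_mem {g : V ≃ₗ[ℚ] V} (hg : g.symm.dualMap ∈ H.dual.hodgeGroup) :
    g ∈ H.hodgeGroup := by
  rw [mem_hodgeGroup_iff]
  intro b a p hp t ht
  set Θ := dualTensorSpaceEquiv (LinearEquiv.refl ℚ (Module.Dual ℚ V)) a b with hΘ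
  have hts : t = Θ (Θ.symm t) := (Θ.apply_symm_apply t).symm
  rw [← tensorSpaceActOver_rat, hts, ← dualTensorSpaceEquiv_tensorSpaceActOver, contragredientOver_refl_apply,
    tensorSpaceActOver_rat,
    (mem_hodgeGroup_iff H.dual _).1 hg a b p (weight_cond_dual_rat' hp) _
      (dualTensorSpaceEquiv_symm_mem_hodgeClasses H ht)]

/-- **Moonen 1999 (1.8), first example, `ℚ`-points: `(g⁻¹)ᵀ ∈ MT(H^∨) ↔ g ∈ MT(H)`.** [cite: Moonen1999MTNotes, (1.8)] -/
theorem symm_dualMap_mem_mumfordTateGroup_dual_iff {g : V ≃ₗ[ℚ] V} :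
    g.symm.dualMap ∈ H.dual.mumfordTateGroup ↔ g ∈ H.mumfordTateGroup :=
  ⟨mem_mumfordTateGroup_of_symm_dualMap_mem, symm_dualMap_mem_mumfordTateGroup_dual⟩

/-- **`(g⁻¹)ᵀ ∈ Hg(H^∨) ↔ g ∈ Hg(H)`** (`ℚ`-points). [cite: Moonen1999MTNotes, (1.8) and (1.11)] -/
theorem symm_dualMap_mem_hodgeGroup_dual_iff {g : V ≃ₗ[ℚ] V} :
    g.symm.dualMap ∈ H.dual.hodgeGroup ↔ g ∈ H.hodgeGroup :=
  ⟨mem_hodgeGroup_of_symm_dualMap_mem, symm_dualMap_mem_hodgeGroup_dual⟩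

/-- **`MT(H^∨)(ℚ)` is the image of `MT(H)(ℚ)` under `g ↦ (g⁻¹)ᵀ`.** [cite: Moonen1999MTNotes, (1.8)] -/
theorem mumfordTateGroup_dual_eq :
    H.dual.mumfordTateGroup =
      H.mumfordTateGroup.map (contragredientOver (LinearEquiv.refl ℚ (Module.Dual ℚ V))) := by
  ext g'
  constructor
  · intro hg'
    obtain ⟨g, rfl⟩ := contragredientOver_surjective (LinearEquiv.refl ℚ (Module.Dual ℚ V)) g'
    rw [contragredientOver_refl_apply] at hg'
    exact ⟨g, mem_mumfordTateGroup_of_symm_dualMap_mem hg', rfl⟩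
  · rintro ⟨g, hg, rfl⟩
    rw [contragredientOver_refl_apply]
    exact symm_dualMap_mem_mumfordTateGroup_dual hg

/-- **`Hg(H^∨)(ℚ)` is the image of `Hg(H)(ℚ)` under `g ↦ (g⁻¹)ᵀ`.** [cite: Moonen1999MTNotes, (1.8) and (1.11)] -/
theorem hodgeGroup_dual_eq :
    H.dual.hodgeGroup = H.hodgeGroup.map (contragredientOver (LinearEquiv.refl ℚ (Module.Dual ℚ V))) := by
  ext g'
  constructor
  · intro hg'
    obtain ⟨g, rfl⟩ := contragredientOver_surjective (LinearEquiv.refl ℚ (Module.Dual ℚ V)) g'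
    rw [contragredientOver_refl_apply] at hg'
    exact ⟨g, mem_hodgeGroup_of_symm_dualMap_mem hg', rfl⟩
  · rintro ⟨g, hg, rfl⟩
    rw [contragredientOver_refl_apply]
    exact symm_dualMap_mem_hodgeGroup_dual hg

end RatPoints

end HodgeStructure

end Literature.AlgebraicGeometry.Motives

end
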